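import Summits.ResolutionOfSingularities.ResolutionOfSingularities.Theorems.FrobeniusLadderFRationalResolutionBlowupFlatCriteria
import Literature.AlgebraicGeometry.Resolution.MarkedIdealsEtale
import Mathlib.AlgebraicGeometry.PullbackCarrier
import HarnessLib

/-!
# Crux `FrobeniusLadder.FRationalResolution` (stmt-ResolutionOfSingularities-15317), line `redirect`,
# stub `stub_diagonalizableQuotientResolution` — **étale comparison of affine blow-ups** (brick P7-c1 of memo
# MEMO-15317-leafhand2-g8 §6: the pointwise form of `…BlowupFlatCriteria.isRegular_affineBlowup_of_flat_of_surjective`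
# needed by the scheme round of the point-blow-up recursion)

Generic. For `φ : B → C` étale (`B`, `C` Noetherian) and `I ⊆ B`: the blow-ups compare by an ÉTALE morphism
`Φ : Bl_{IC}(Spec C) → Bl_I(Spec B)` over `Spec φ` (flat base change `IsBlowup.pullback_snd_of_flat` + uniqueness
`IsBlowup.unique`), along which regularity of local rings is preserved and reflected (Matsumura 23.7,
`isRegularLocalRing_stalk_iff_of_etale`), and which hits every point of `Bl_I(Spec B)` over a point of `Spec B` in
the image of `Spec C`.

* **`exists_etale_comparison`** — the statement above.

Honest label: scheme plumbing toward ONE leaf stub (no stub, crux or summit closed). No definitions, no named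
facts, no sorry. [cite: GortzWedhorn2020, Prop. 13.91 (2)] [cite: Matsumura1987, Thm. 23.7]
-/

noncomputable section

-- single-problem summit: the doubled namespace component is forced
set_option linter.dupNamespace false

open CategoryTheory CategoryTheory.Limits AlgebraicGeometry TopologicalSpace
open Literature.AlgebraicGeometry.Resolution

namespace Summit.ResolutionOfSingularities.ResolutionOfSingularities.Theorems.FRationalResolution.EtaleBlowupComparison

/-- **Étale comparison of affine blow-ups.** See the module docstring. [cite: GortzWedhorn2020, Prop. 13.91 (2)]
[cite: Matsumura1987, Thm. 23.7] -/
theorem exists_etale_comparison {B C : Type} [CommRing B] [CommRing C] [IsNoetherianRing B] [IsNoetherianRing C]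
    (φ : B →+* C) (hφ : φ.Etale) (I : Ideal B) :
    ∃ Φ : affineBlowup (I.map φ) ⟶ affineBlowup I, Etale Φ ∧
      Φ ≫ affineBlowup.π I = affineBlowup.π (I.map φ) ≫ Spec.map (CommRingCat.ofHom φ) ∧
      (∀ y' : affineBlowup (I.map φ),
        IsRegularLocalRing ((affineBlowup (I.map φ)).presheaf.stalk y') ↔
          IsRegularLocalRing ((affineBlowup I).presheaf.stalk (Φ y'))) ∧
      (∀ (y : affineBlowup I) (z : Spec (.of C)), affineBlowup.π I y = Spec.map (CommRingCat.ofHom φ) z →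
        ∃ y' : affineBlowup (I.map φ), Φ y' = y ∧ affineBlowup.π (I.map φ) y' = z) := by
  set ι : Spec (.of C) ⟶ Spec (.of B) := Spec.map (CommRingCat.ofHom φ) with hι
  haveI : Etale ι := (HasRingHomProperty.Spec_iff (P := @Etale)).mpr hφ
  haveI : IsLocallyNoetherian (affineBlowup I) := LocallyOfFiniteType.isLocallyNoetherian (affineBlowup.π I)
  haveI : IsLocallyNoetherian (affineBlowup (I.map φ)) :=
    LocallyOfFiniteType.isLocallyNoetherian (affineBlowup.π (I.map φ))
  -- the pullback is a blow-up of `Spec C` along `IC`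
  have hpb : IsBlowup (pullback.snd (affineBlowup.π I) ι) (affineBlowup.idealSheaf (I.map φ)) := by
    have h := (affineBlowup.isBlowup I).pullback_snd_of_flat ι
    rwa [hι, BlowupFlatCriteria.idealSheaf_comap_specMap] at h
  obtain ⟨e, he, he'⟩ := (affineBlowup.isBlowup (I.map φ)).unique hpb
  refine ⟨e.hom ≫ pullback.fst (affineBlowup.π I) ι, inferInstance, ?_, fun y' => ?_, fun y z hyz => ?_⟩
  · rw [Category.assoc, pullback.condition, ← Category.assoc, he]
  · exact isRegularLocalRing_stalk_iff_of_etale (e.hom ≫ pullback.fst (affineBlowup.π I) ι) y'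
  · obtain ⟨w, hw1, hw2⟩ := Scheme.Pullback.exists_preimage_pullback (f := affineBlowup.π I) (g := ι) y z hyz
    refine ⟨e.inv w, ?_, ?_⟩
    · show (e.inv ≫ e.hom ≫ pullback.fst (affineBlowup.π I) ι) w = y
      rw [Iso.inv_hom_id_assoc]; exact hw1
    · show (e.inv ≫ affineBlowup.π (I.map φ)) w = z
      rw [he']; exact hw2

end Summit.ResolutionOfSingularities.ResolutionOfSingularities.Theorems.FRationalResolution.EtaleBlowupComparison

end

/-! ## Appendix (same generation): open immersions (localizations) -/

noncomputable section

-- single-problem summit: the doubled namespace component is forced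
set_option linter.dupNamespace false

open CategoryTheory CategoryTheory.Limits AlgebraicGeometry TopologicalSpace
open Literature.AlgebraicGeometry.Resolution

namespace Summit.ResolutionOfSingularities.ResolutionOfSingularities.Theorems.FRationalResolution.EtaleBlowupComparison

/-- **Open-immersion comparison of affine blow-ups** (e.g. `φ : C → C_g` a localization): if `Spec φ` is an open
immersion then the comparison `Φ : Bl_{IC'}(Spec C') → Bl_I(Spec C)` can be taken to be an OPEN IMMERSION over
`Spec φ` (in particular injective), preserving/reflecting regularity and hitting every point over the image of
`Spec C'`. [cite: GortzWedhorn2020, Prop. 13.91 (2)] -/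
theorem exists_openImmersion_comparison {B C : Type} [CommRing B] [CommRing C] [IsNoetherianRing B]
    [IsNoetherianRing C] (φ : B →+* C) [IsOpenImmersion (Spec.map (CommRingCat.ofHom φ))] (I : Ideal B) :
    ∃ Φ : affineBlowup (I.map φ) ⟶ affineBlowup I, IsOpenImmersion Φ ∧
      Φ ≫ affineBlowup.π I = affineBlowup.π (I.map φ) ≫ Spec.map (CommRingCat.ofHom φ) ∧
      (∀ y' : affineBlowup (I.map φ),
        IsRegularLocalRing ((affineBlowup (I.map φ)).presheaf.stalk y') ↔
          IsRegularLocalRing ((affineBlowup I).presheaf.stalk (Φ y'))) ∧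
      (∀ (y : affineBlowup I) (z : Spec (.of C)), affineBlowup.π I y = Spec.map (CommRingCat.ofHom φ) z →
        ∃ y' : affineBlowup (I.map φ), Φ y' = y ∧ affineBlowup.π (I.map φ) y' = z) := by
  set ι : Spec (.of C) ⟶ Spec (.of B) := Spec.map (CommRingCat.ofHom φ) with hι
  haveI : IsLocallyNoetherian (affineBlowup I) := LocallyOfFiniteType.isLocallyNoetherian (affineBlowup.π I)
  haveI : IsLocallyNoetherian (affineBlowup (I.map φ)) :=
    LocallyOfFiniteType.isLocallyNoetherian (affineBlowup.π (I.map φ))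
  have hpb : IsBlowup (pullback.snd (affineBlowup.π I) ι) (affineBlowup.idealSheaf (I.map φ)) := by
    have h := (affineBlowup.isBlowup I).pullback_snd_of_flat ι
    rwa [hι, BlowupFlatCriteria.idealSheaf_comap_specMap] at h
  obtain ⟨e, he, he'⟩ := (affineBlowup.isBlowup (I.map φ)).unique hpb
  refine ⟨e.hom ≫ pullback.fst (affineBlowup.π I) ι, inferInstance, ?_, fun y' => ?_, fun y z hyz => ?_⟩
  · rw [Category.assoc, pullback.condition, ← Category.assoc, he]
  · exact isRegularLocalRing_stalk_iff_of_etale (e.hom ≫ pullback.fst (affineBlowup.π I) ι) y'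
  · obtain ⟨w, hw1, hw2⟩ := Scheme.Pullback.exists_preimage_pullback (f := affineBlowup.π I) (g := ι) y z hyz
    refine ⟨e.inv w, ?_, ?_⟩
    · show (e.inv ≫ e.hom ≫ pullback.fst (affineBlowup.π I) ι) w = y
      rw [Iso.inv_hom_id_assoc]; exact hw1
    · show (e.inv ≫ affineBlowup.π (I.map φ)) w = z
      rw [he']; exact hw2

end Summit.ResolutionOfSingularities.ResolutionOfSingularities.Theorems.FRationalResolution.EtaleBlowupComparison

end
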